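/-
Copyright (c) 2026 the pub-hodgecm-mathlib formalisation cell (harness21).  Prover seat hodgecm-mathlib-K2E5-p17 (g6), HCML Track B «K2-LIT» ∕ h413
(`stmt-HodgeConjecture-24833`), line «SC′-IRR-lev» (leaf (S-C′-irr) `sig_K2E3GL3TwoBlockInducedIrreducible`; lead K2E3-p24 (g2), dealer K2E3-plan (g4)),
brick JM-B file 2b: the CLOSED `P₍₂,₁₎`-orbit `Z = {g₂₀ = 0}` contributes nothing to the `N'`-Jacquet module for a `GL₂`-cuspidal block.  2026-09-04.
-/
import Summits.HodgeConjecture.HodgeConjecture.Theorems.K2E3GL3CuspidalBlockClosedCellPrep   -- ★ JM-B file 2a (this seat): kernel tools, stable box, `Z = P · (M' ∩ GL₃(𝒪))`, finite values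
import HarnessLib

/-!
# K2_E3 road (h413), line «SC′-IRR-lev», brick JM-B (file 2b) — the closed `P₍₂,₁₎`-orbit `Z = {g | g₂₀ = 0} ⊂ GL₃(F)` is invisible in the `N'`-Jacquet module of
# `Ind_{P₍₂,₁₎}^{GL₃} σ'` when `W(x₀₁) = W`

Cell `pub/hodgecm-mathlib` (D-0151), Track B, seat K2E5-p17 (g6) (hand JM-B of line «SC′-IRR-lev», lead K2E3-p24 (g2) FILE PLAN v2 10:20:22Z + SPEC 10:27:03Z).
`--supports stmt-HodgeConjecture-24833 --as helper`; THEOREMS ONLY (no definition ∕ instance ∕ notation ∕ named fact ∕ `sorry`); never imports `Cruxes/…/Lines`.  COUNT-NEUTRAL.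

THE MATHEMATICS ([BernsteinZelevinsky1977, Geometrical Lemma 2.12 and Thm. 5.2 — the closed orbit of the pair `(P₍₂,₁₎, P₍₁,₂₎)`; §1.8–1.9]; [BernsteinZelevinsky1976, §2.3, §2.33];
[Casselman1995, §2.1, §6.3]).  `F` a non-archimedean local field, `c₀ = ![0,0,1]`, `P = standardParabolicGL F c₀ = P₍₂,₁₎`, `N' = oppositeCellRadical c₀` (= `U_{P₍₁,₂₎}`, ★ K0
`oppositeCellRadical_eq_unipotentRadicalGL_oneTwo`), `P' = standardParabolicGL F (toDual ∘ revLabel c₀) = P₍₁,₂₎`, `M' ∩ GL₃(𝒪) = glInt 3 F ⊓ standardLeviGL F ![0,1,1]`, `σ'` a smooth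
representation of `P` on `W`, `I = Ind_P^{GL₃} σ'`, `[f]` the class of `f` in the coinvariants of `I ∘ N'.subtype`, and `I_open = vanishingOn P σ' (cellLT c₀ w₀)` the functions vanishing on
the closed orbit `Z = cellLT c₀ w₀ = {g | g₂₀ = 0}` (★ K0 `mem_cellLT_iff_apply_eq_zero`).

**Theorem** (`exists_mem_vanishingOn_mk_comp_eq`, §6).  If `W(N') = W` — every `w ∈ W` lies in the coinvariant kernel of `σ'|_{N'}` (which holds as soon as `W(x₀₁) = W`,
`forall_mem_coinvariantsKer_inclusion_of_span`, since `x₀₁(F) ≤ N'`; for `σ' = σ ∘ proj ⊗ δ^{1∕2}` with `σ` cuspidal on the `GL₂` block this is ★ BLK `mem_span_twist_transvection_zero_one_sub`) —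
then every `f ∈ I` has `[f] = [f₀]` for some `f₀ ∈ I_open`.  PROOF.  `f₀ := e_B f` is the average of `f` over a compact open subgroup `B ≤ N'` (★ `Representation.avgProj`;
`f − e_B f ∈ I(B) ⊆ I(N')`, ★ `sub_avgProj_mem_coinvariantsKer`).  It vanishes on `Z` once `B` is large and symmetric enough (★ file 2a): every `z ∈ Z` is `p · m₀` with `p ∈ P` and
`m₀ ∈ M' ∩ GL₃(𝒪)`; the values `f(m₀)` form a finite set `{f(y) : y ∈ S}`; each `u = f(y) ∈ W(N')` lies in `W(K_u)` for a compact open `K_u ≤ N'`; there is a compact open subgroup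
`B ≥ ⋃ K_u` of `N'` normalised by `M' ∩ GL₃(𝒪)`; and (§5) for such `B` and `m₀`:
`(e_B f)(m₀) = |R|⁻¹ Σ_{r ∈ R} f(m₀ r) = |R|⁻¹ Σ_r σ'(m₀ r m₀⁻¹) f(m₀) = |R'|⁻¹ Σ_{r' ∈ R'} σ'(r') u = e_B(u) = 0`, where `R' = m₀ R m₀⁻¹` is again a transversal in `B` (★ `avgProj_eq`)
and `e_B` kills `W(B) ∋ u` (★ `avgProj_eq_zero_of_mem_coinvariantsKer`, the compact-subgroup half of Jacquet's lemma).  Hence `f₀(p m₀) = σ'(p) f₀(m₀) = 0` on `Z`.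

* §5 `toFun_avgProj_eq_zero` — the point computation `(e_B f)(m₀) = 0`.
* §6 **`exists_mem_vanishingOn_mk_comp_eq`** (hypothesis `W(N') = W`), `forall_mem_coinvariantsKer_inclusion_of_span`, **`exists_mem_vanishingOn_mk_comp_eq_of_span`** (hypothesis
  `hW₀₁ : ∀ w, w ∈ span ℂ {σ' ⟨x₀₁ a, _⟩ v − v}` VERBATIM as ★ BLK `mem_span_twist_transvection_zero_one_sub` delivers it).
File 2c (`K2E3GL3CuspidalBlockJacquetCross`) moves these classes to the `jacquetGL F ![0,1,1]` currency and proves the irreducibility head of the lead's SPEC.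

HONEST LABEL: HC_CM is proved only modulo the 7 printed citations (2 remaining named inputs: hLiu418 = stmt-HodgeConjecture-24832, h413 = stmt-HodgeConjecture-24833) until rung 0
closes; count-neutral helper (kernel lane).

## Mathlib ∕ tree search
★ file 2a (`exists_compactOpen_mem_coinvariantsKer`, `exists_subgroup_radicalConj_stable`, `exists_eq_parabolic_mul_of_apply_two_zero_eq_zero`, `exists_finite_forall_toFun_eq`,
`isLeftTransversal_image_mulEquiv`, `oppositeCellRadical_le_standardParabolicGL`), ★ K0 (`mem_cellLT_iff_apply_eq_zero`, `transvectionUnit_zero_one_mem_oppositeCellRadical`,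
`transvectionUnit_zero_one_mem_standardParabolicGL`), ★ `OpenCellSections` (`radicalConj`, `coe_radicalConj_symm`, `mul_mul_inv_mem_oppositeCellRadical_of_mem`), ★ `CompactOpenAveraging`
(`avgProj`, `avgProj_eq`, `exists_isLeftTransversal`), ★ `IntertwiningMapCharacterCoinvariants` §3 (`sub_avgProj_mem_coinvariantsKer`, `avgProj_eq_zero_of_mem_coinvariantsKer`),
★ `UnipotentRadicalCompactOpenProofs` (`isLimitOfCompactOpen_unipotentRadicalGL`), Mathlib `Representation.Coinvariants.mk_eq_iff`.  Dedup: `rg "CuspidalBlockClosedCell"` — none.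

## References
* [BernsteinZelevinsky1977] I. N. Bernstein, A. V. Zelevinsky, *Induced representations of reductive 𝔭-adic groups I*, Ann. Sci. ÉNS 10 (1977), §1.8–1.9, Lemma 2.12, Thm. 5.2.
* [BernsteinZelevinsky1976] I. N. Bernstein, A. V. Zelevinsky, *Representations of the group GL(n, F) where F is a non-archimedean local field*, Russian Math. Surveys 31:3
  (1976), §2.3, §2.33.
* [Casselman1995] W. Casselman, *Introduction to the theory of admissible representations of 𝔭-adic reductive groups* (draft 1995), §2.1, §6.3.
-/

set_option autoImplicit false
set_option linter.dupNamespace false   -- `Summit.HodgeConjecture.HodgeConjecture.…` (D-0017 nested layout; lakefile exemption for Summits)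

noncomputable section

open scoped BigOperators Pointwise ValuativeRel
open Matrix OrderDual Topology ValuativeRel
open Literature.NumberTheory.Automorphic
open Summit.HodgeConjecture.HodgeConjecture.Cruxes.H413.K2E3GL3MaximalParabolicRelabel
open Summit.HodgeConjecture.HodgeConjecture.Cruxes.H413.K2E3GL3CuspidalBlockClosedCellPrep

namespace Summit.HodgeConjecture.HodgeConjecture.Cruxes.H413.K2E3GL3CuspidalBlockClosedCell

variable {F : Type*} [Field F] [ValuativeRel F] [TopologicalSpace F] [IsNonarchimedeanLocalField F]

/-! ## §5  The point computation: `(e_B f)(m₀) = 0` -/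

section Point

variable {W : Type*} [AddCommGroup W] [Module ℂ W] {σ' : Representation ℂ ↥(standardParabolicGL F (![0, 0, 1] : Fin 3 → Fin 2)) W}

/-- **`(e_B f)(m₀) = 0`** for a compact open `B ≤ N'` normalised by `m₀ ∈ P'`, when `u = f(m₀)` lies in `W(B)` (the coinvariant kernel of `σ'|_B`):
`(e_B f)(m₀) = |R|⁻¹ Σ_{r∈R} f(m₀ r) = |R|⁻¹ Σ_r σ'(m₀ r m₀⁻¹) u` and `m₀ R m₀⁻¹` is a transversal of `B` modulo the conjugated stabiliser, which fixes `u`, so the sum is `|R| · e_B(u) = 0`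
(★ `avgProj_eq`, ★ `avgProj_eq_zero_of_mem_coinvariantsKer`). [cite: BernsteinZelevinsky1976, §2.33] [cite: Casselman1995, §2.1 and §6.3] -/
theorem toFun_avgProj_eq_zero (hσ' : σ'.IsSmooth)
    (B : Subgroup ↥(oppositeCellRadical (K := F) (![0, 0, 1] : Fin 3 → Fin 2)))
    (hBc : IsCompact (B : Set ↥(oppositeCellRadical (K := F) (![0, 0, 1] : Fin 3 → Fin 2))))
    {m₀ : GL (Fin 3) F} (hm₀ : m₀ ∈ standardParabolicGL F (⇑toDual ∘ revLabel (![0, 0, 1] : Fin 3 → Fin 2)))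
    (hstab : ∀ x : ↥(oppositeCellRadical (K := F) (![0, 0, 1] : Fin 3 → Fin 2)), radicalConj hm₀ x ∈ B ↔ x ∈ B)
    (f : Representation.SmoothInd (standardParabolicGL F (![0, 0, 1] : Fin 3 → Fin 2)) σ')
    (hu : f.toFun m₀ ∈ Representation.Coinvariants.ker
      ((σ'.comp (Subgroup.inclusion (oppositeCellRadical_le_standardParabolicGL (F := F)))).comp B.subtype)) :
    (Representation.avgProj ((Representation.smoothIndRep (standardParabolicGL F (![0, 0, 1] : Fin 3 → Fin 2)) σ').comp
        (oppositeCellRadical (K := F) (![0, 0, 1] : Fin 3 → Fin 2)).subtype) B f).toFun m₀ = 0 := by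
  classical
  -- smoothness of the two restricted representations
  have hINs : Representation.IsSmooth ((Representation.smoothIndRep (standardParabolicGL F (![0, 0, 1] : Fin 3 → Fin 2)) σ').comp
      (oppositeCellRadical (K := F) (![0, 0, 1] : Fin 3 → Fin 2)).subtype) :=
    (Representation.isSmooth_smoothInd (standardParabolicGL F (![0, 0, 1] : Fin 3 → Fin 2)) σ').comp
      (oppositeCellRadical (K := F) (![0, 0, 1] : Fin 3 → Fin 2)).subtype continuous_subtype_val
  have hincl : Continuous (Subgroup.inclusion (oppositeCellRadical_le_standardParabolicGL (F := F))) :=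
    continuous_induced_rng.2 continuous_subtype_val
  have hσNs : Representation.IsSmooth (σ'.comp (Subgroup.inclusion (oppositeCellRadical_le_standardParabolicGL (F := F)))) := hσ'.comp _ hincl
  -- the transversal computing `e_B f`
  have hTo : IsOpen ((Representation.stabilizerSubgroup ((Representation.smoothIndRep (standardParabolicGL F (![0, 0, 1] : Fin 3 → Fin 2)) σ').comp
      (oppositeCellRadical (K := F) (![0, 0, 1] : Fin 3 → Fin 2)).subtype) f :
        Subgroup ↥(oppositeCellRadical (K := F) (![0, 0, 1] : Fin 3 → Fin 2))) : Set ↥(oppositeCellRadical (K := F) (![0, 0, 1] : Fin 3 → Fin 2))) := hINs f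
  obtain ⟨R, hR⟩ := exists_isLeftTransversal (B := B) hBc hTo
  have hf₀ := Representation.avgProj_eq hBc hTo (fun t ht => (Representation.mem_stabilizerSubgroup _ f t).1 ht) hR
  rw [hf₀, Representation.SmoothInd.toFun_smul, Pi.smul_apply, Representation.SmoothInd.toFun_sum]
  -- each term: `f(m₀ r) = σ'(m₀ r m₀⁻¹) f(m₀)`
  have hterm : ∀ r ∈ R, ((((Representation.smoothIndRep (standardParabolicGL F (![0, 0, 1] : Fin 3 → Fin 2)) σ').comp
      (oppositeCellRadical (K := F) (![0, 0, 1] : Fin 3 → Fin 2)).subtype) r) f).toFun m₀ =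
        (σ'.comp (Subgroup.inclusion (oppositeCellRadical_le_standardParabolicGL (F := F)))) (radicalConj hm₀ r) (f.toFun m₀) := by
    intro r _
    change ((Representation.smoothIndRep (standardParabolicGL F (![0, 0, 1] : Fin 3 → Fin 2)) σ'
        (r : GL (Fin 3) F)) f).toFun m₀ =
      σ' ⟨m₀ * (r : GL (Fin 3) F) * m₀⁻¹, oppositeCellRadical_le_standardParabolicGL (mul_mul_inv_mem_oppositeCellRadical_of_mem hm₀ r.2)⟩ (f.toFun m₀)
    rw [Representation.toFun_smoothIndRep_apply]
    have e : m₀ * (r : GL (Fin 3) F) = m₀ * (r : GL (Fin 3) F) * m₀⁻¹ * m₀ := by rw [inv_mul_cancel_right]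
    conv_lhs => rw [e]
    exact Representation.SmoothInd.toFun_subgroup_mul f ⟨m₀ * (r : GL (Fin 3) F) * m₀⁻¹, _⟩ m₀
  rw [Finset.sum_congr rfl hterm, ← Finset.sum_image (f := fun r' => (σ'.comp (Subgroup.inclusion
      (oppositeCellRadical_le_standardParabolicGL (F := F)))) r' (f.toFun m₀)) (fun x _ y _ h => (radicalConj hm₀).injective h)]
  -- the conjugated transversal
  have hBcomap : B.comap (radicalConj hm₀).symm.toMonoidHom = B := Subgroup.ext fun x => by
    rw [Subgroup.mem_comap, MulEquiv.coe_toMonoidHom]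
    conv_rhs => rw [← (radicalConj hm₀).apply_symm_apply x]
    exact (hstab _).symm
  have hR' := isLeftTransversal_image_mulEquiv hR (radicalConj hm₀)
  rw [Subgroup.comap_inf, hBcomap] at hR'
  -- the conjugated stabiliser is open and fixes `u = f(m₀)`
  have hsymm : Continuous (radicalConj hm₀).symm := by
    refine continuous_induced_rng.2 ?_
    have : (Subtype.val ∘ (radicalConj hm₀).symm) = fun x : ↥(oppositeCellRadical (K := F) (![0, 0, 1] : Fin 3 → Fin 2)) =>
        m₀⁻¹ * (x : GL (Fin 3) F) * m₀ := funext fun x => coe_radicalConj_symm hm₀ x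
    rw [this]
    exact (continuous_const.mul continuous_subtype_val).mul continuous_const
  have hT'o : IsOpen (((Representation.stabilizerSubgroup ((Representation.smoothIndRep (standardParabolicGL F (![0, 0, 1] : Fin 3 → Fin 2)) σ').comp
      (oppositeCellRadical (K := F) (![0, 0, 1] : Fin 3 → Fin 2)).subtype) f).comap
        (radicalConj hm₀).symm.toMonoidHom : Subgroup ↥(oppositeCellRadical (K := F) (![0, 0, 1] : Fin 3 → Fin 2))) :
          Set ↥(oppositeCellRadical (K := F) (![0, 0, 1] : Fin 3 → Fin 2))) :=
    hTo.preimage hsymm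
  have hT'u : ∀ t ∈ (Representation.stabilizerSubgroup ((Representation.smoothIndRep (standardParabolicGL F (![0, 0, 1] : Fin 3 → Fin 2)) σ').comp
      (oppositeCellRadical (K := F) (![0, 0, 1] : Fin 3 → Fin 2)).subtype) f).comap (radicalConj hm₀).symm.toMonoidHom,
      (σ'.comp (Subgroup.inclusion (oppositeCellRadical_le_standardParabolicGL (F := F)))) t (f.toFun m₀) = f.toFun m₀ := by
    intro t ht
    rw [Subgroup.mem_comap, MulEquiv.coe_toMonoidHom, Representation.mem_stabilizerSubgroup] at ht
    have h := congrArg (fun g : Representation.SmoothInd (standardParabolicGL F (![0, 0, 1] : Fin 3 → Fin 2)) σ' => g.toFun m₀) ht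
    simp only [MonoidHom.coe_comp, Function.comp_apply, Subgroup.coe_subtype, Representation.toFun_smoothIndRep_apply,
      coe_radicalConj_symm] at h
    rw [show m₀ * (m₀⁻¹ * (t : GL (Fin 3) F) * m₀) = (t : GL (Fin 3) F) * m₀ by rw [← mul_assoc, ← mul_assoc, mul_inv_cancel, one_mul]] at h
    change σ' ⟨(t : GL (Fin 3) F), oppositeCellRadical_le_standardParabolicGL t.2⟩ (f.toFun m₀) = f.toFun m₀
    rw [← Representation.SmoothInd.toFun_subgroup_mul f ⟨(t : GL (Fin 3) F), _⟩ m₀]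
    exact h
  -- `Σ_{r'} σ'(r') u = |R'| • e_B u = 0`
  have havg := Representation.avgProj_eq hBc hT'o hT'u hR'
  rw [Representation.avgProj_eq_zero_of_mem_coinvariantsKer _ hBc hσNs hu] at havg
  have hcard : (((R.image (radicalConj hm₀)).card : ℂ))⁻¹ ≠ 0 :=
    inv_ne_zero (Nat.cast_ne_zero.2 (Finset.card_ne_zero.2 hR'.nonempty))
  rw [(smul_eq_zero.1 havg.symm).resolve_left hcard, smul_zero]

end Point

/-! ## §6  The closed orbit contributes nothing: `[f] = [f₀]` with `f₀ ∈ I_open` -/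

section Closed

variable {W : Type*} [AddCommGroup W] [Module ℂ W] (σ' : Representation ℂ ↥(standardParabolicGL F (![0, 0, 1] : Fin 3 → Fin 2)) W)

/-- **THE CLOSED `P₍₂,₁₎`-ORBIT IS INVISIBLE IN THE `N'`-JACQUET MODULE WHEN `W(N') = W`.**  For `σ'` smooth with every vector in the coinvariant kernel of `σ'|_{N'}`, every
`f ∈ I = Ind_P^{GL₃} σ'` is congruent modulo `I(N')` to an `f₀` vanishing on `Z = {g | g₂₀ = 0}`: `[f] = [f₀]` in the coinvariants of `I ∘ N'.subtype`, `f₀ ∈ vanishingOn P σ' (cellLT ![0,0,1] w₀)`.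
(Proof in the module docstring: `f₀ = e_B f` for a large `Ad(M' ∩ GL₃(𝒪))`-stable compact open `B ≤ N'`.) [cite: BernsteinZelevinsky1977, Lemma 2.12 and Thm. 5.2] [cite: Casselman1995, §6.3] -/
theorem exists_mem_vanishingOn_mk_comp_eq (hσ' : σ'.IsSmooth)
    (hW : ∀ w : W, w ∈ Representation.Coinvariants.ker (σ'.comp (Subgroup.inclusion (oppositeCellRadical_le_standardParabolicGL (F := F)))))
    (f : Representation.SmoothInd (standardParabolicGL F (![0, 0, 1] : Fin 3 → Fin 2)) σ') :
    ∃ f₀ ∈ vanishingOn (standardParabolicGL F (![0, 0, 1] : Fin 3 → Fin 2)) σ' (cellLT (K := F) (![0, 0, 1] : Fin 3 → Fin 2) Fin.revPerm),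
      Representation.Coinvariants.mk ((Representation.smoothIndRep (standardParabolicGL F (![0, 0, 1] : Fin 3 → Fin 2)) σ').comp
          (oppositeCellRadical (K := F) (![0, 0, 1] : Fin 3 → Fin 2)).subtype) f =
        Representation.Coinvariants.mk ((Representation.smoothIndRep (standardParabolicGL F (![0, 0, 1] : Fin 3 → Fin 2)) σ').comp
          (oppositeCellRadical (K := F) (![0, 0, 1] : Fin 3 → Fin 2)).subtype) f₀ := by
  classical
  haveI : T2Space F := (Literature.NumberTheory.GaloisRepresentations.IsNonarchimedeanLocalField.isLocalField F).toT2Space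
  have hlim : IsLimitOfCompactOpen ↥(oppositeCellRadical (K := F) (![0, 0, 1] : Fin 3 → Fin 2)) :=
    isLimitOfCompactOpen_unipotentRadicalGL F (⇑toDual ∘ revLabel (![0, 0, 1] : Fin 3 → Fin 2)) (monotone_toDual_revLabel _ monotone_twoOne)
  -- (§4) finitely many values on `M' ∩ GL₃(𝒪)`
  have hH₀c : IsCompact ((glInt 3 F ⊓ standardLeviGL F (![0, 1, 1] : Fin 3 → Fin 2) : Subgroup (GL (Fin 3) F)) : Set (GL (Fin 3) F)) := by
    rw [Subgroup.coe_inf]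
    exact (isCompact_glInt 3 F).inter_right (isClosed_standardLeviGL (R := F) (![0, 1, 1] : Fin 3 → Fin 2))
  obtain ⟨S, -, hSfin, hS⟩ := exists_finite_forall_toFun_eq f hH₀c
  -- (§1) one compact open `K_y ≤ N'` per value, and one `K` above all of them
  choose Ky hKyo hKyc hKy using fun y : GL (Fin 3) F =>
    exists_compactOpen_mem_coinvariantsKer (σ'.comp (Subgroup.inclusion (oppositeCellRadical_le_standardParabolicGL (F := F)))) hlim (hW (f.toFun y))
  obtain ⟨K, hKo, hKc, hKsub⟩ := hlim (⋃ y ∈ S, (Ky y : Set _)) (hSfin.isCompact_biUnion fun y _ => hKyc y)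
  -- (§2) a stable compact open `B ≥ K`
  obtain ⟨B, -, hBc, hKB, hstab⟩ := exists_subgroup_radicalConj_stable K hKo hKc
  have huB : ∀ y ∈ S, f.toFun y ∈ Representation.Coinvariants.ker
      ((σ'.comp (Subgroup.inclusion (oppositeCellRadical_le_standardParabolicGL (F := F)))).comp B.subtype) := fun y hy =>
    coinvariantsKer_comp_subtype_mono _ (fun x hx => hKB (hKsub (Set.mem_biUnion hy hx))) (hKy y)
  -- `f₀ = e_B f`
  refine ⟨Representation.avgProj ((Representation.smoothIndRep (standardParabolicGL F (![0, 0, 1] : Fin 3 → Fin 2)) σ').comp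
      (oppositeCellRadical (K := F) (![0, 0, 1] : Fin 3 → Fin 2)).subtype) B f, ?_, ?_⟩
  · -- `f₀` vanishes on `Z = P · (M' ∩ GL₃(𝒪))`
    intro z hz
    rw [mem_cellLT_iff_apply_eq_zero] at hz
    obtain ⟨p, hp, m₀, hm₀, rfl⟩ := exists_eq_parabolic_mul_of_apply_two_zero_eq_zero z hz
    obtain ⟨y, hy, hfy⟩ := hS m₀ hm₀
    rw [show p * m₀ = ((⟨p, hp⟩ : ↥(standardParabolicGL F (![0, 0, 1] : Fin 3 → Fin 2))) : GL (Fin 3) F) * m₀ from rfl,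
      Representation.SmoothInd.toFun_subgroup_mul,
      toFun_avgProj_eq_zero hσ' B hBc (inf_standardLeviGL_le_reversedParabolic hm₀) (fun x => hstab hm₀ x) f (hfy ▸ huB y hy), map_zero]
  · -- `[f] = [e_B f]`
    have hsv : Representation.IsSmoothVector ((Representation.smoothIndRep (standardParabolicGL F (![0, 0, 1] : Fin 3 → Fin 2)) σ').comp
        (oppositeCellRadical (K := F) (![0, 0, 1] : Fin 3 → Fin 2)).subtype) f :=
      ((Representation.isSmooth_smoothInd (standardParabolicGL F (![0, 0, 1] : Fin 3 → Fin 2)) σ').comp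
        (oppositeCellRadical (K := F) (![0, 0, 1] : Fin 3 → Fin 2)).subtype continuous_subtype_val) f
    rw [Representation.Coinvariants.mk_eq_iff]
    exact coinvariantsKer_comp_subtype_le _ B (Representation.sub_avgProj_mem_coinvariantsKer _ hBc hsv)

omit [ValuativeRel F] [TopologicalSpace F] [IsNonarchimedeanLocalField F] in
/-- `W(x₀₁) = W ⇒ W(N') = W`: the hypothesis in the form ★ BLK `mem_span_twist_transvection_zero_one_sub` delivers it (`x₀₁(F) ≤ N'`, ★ K0
`transvectionUnit_zero_one_mem_oppositeCellRadical`). [cite: BernsteinZelevinsky1977, §1.8] -/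
theorem forall_mem_coinvariantsKer_inclusion_of_span
    (hW₀₁ : ∀ w : W, w ∈ Submodule.span ℂ {x : W | ∃ (a : F) (v : W),
      x = σ' ⟨transvectionUnit 0 1 (by decide) a, transvectionUnit_zero_one_mem_standardParabolicGL a⟩ v - v})
    (w : W) :
    w ∈ Representation.Coinvariants.ker (σ'.comp (Subgroup.inclusion (oppositeCellRadical_le_standardParabolicGL (F := F)))) := by
  refine Submodule.span_le.2 ?_ (hW₀₁ w)
  rintro _ ⟨a, v, rfl⟩
  exact Representation.Coinvariants.mem_ker_of_eq (ρ := σ'.comp (Subgroup.inclusion (oppositeCellRadical_le_standardParabolicGL (F := F))))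
    ⟨transvectionUnit 0 1 (by decide) a, transvectionUnit_zero_one_mem_oppositeCellRadical a⟩ v _ rfl

/-- **THE CLOSED ORBIT IS INVISIBLE, hypothesis `W(x₀₁) = W`** (the form JM-B consumes; `hW₀₁` = ★ BLK `mem_span_twist_transvection_zero_one_sub`): every `f ∈ Ind_P^{GL₃} σ'` has
`[f] = [f₀]` in the `N'`-coinvariants for some `f₀` vanishing on `{g₂₀ = 0}`. [cite: BernsteinZelevinsky1977, Lemma 2.12 and Thm. 5.2] [cite: Casselman1995, §6.3] -/
theorem exists_mem_vanishingOn_mk_comp_eq_of_span (hσ' : σ'.IsSmooth)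
    (hW₀₁ : ∀ w : W, w ∈ Submodule.span ℂ {x : W | ∃ (a : F) (v : W),
      x = σ' ⟨transvectionUnit 0 1 (by decide) a, transvectionUnit_zero_one_mem_standardParabolicGL a⟩ v - v})
    (f : Representation.SmoothInd (standardParabolicGL F (![0, 0, 1] : Fin 3 → Fin 2)) σ') :
    ∃ f₀ ∈ vanishingOn (standardParabolicGL F (![0, 0, 1] : Fin 3 → Fin 2)) σ' (cellLT (K := F) (![0, 0, 1] : Fin 3 → Fin 2) Fin.revPerm),
      Representation.Coinvariants.mk ((Representation.smoothIndRep (standardParabolicGL F (![0, 0, 1] : Fin 3 → Fin 2)) σ').comp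
          (oppositeCellRadical (K := F) (![0, 0, 1] : Fin 3 → Fin 2)).subtype) f =
        Representation.Coinvariants.mk ((Representation.smoothIndRep (standardParabolicGL F (![0, 0, 1] : Fin 3 → Fin 2)) σ').comp
          (oppositeCellRadical (K := F) (![0, 0, 1] : Fin 3 → Fin 2)).subtype) f₀ :=
  exists_mem_vanishingOn_mk_comp_eq σ' hσ' (forall_mem_coinvariantsKer_inclusion_of_span σ' hW₀₁) f

end Closed

end Summit.HodgeConjecture.HodgeConjecture.Cruxes.H413.K2E3GL3CuspidalBlockClosedCell

end
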